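import Summits.ABC.IUTFork.LDHGenuineStepVSum
import Mathlib.NumberTheory.PrimeCounting
import Mathlib.Analysis.Complex.ExponentialBounds
import HarnessLib

/-!
# The fork at [IUTchIII] Corollary 3.12, L-DH level: [IUTchIV] Thm. 1.10 Step (v) for the GENUINE datum in the
# K-LEVEL currency (V) of the route's junction — `e*_mod·l`, `l*_mod`, `log(𝔰^ℚ)`, `log(𝔰^≤) ≤ π(e*_mod·l)`, (R4)
# (abc-iut cell, crux ThetaPartII = stmt-ABC-19678, child (ii′) `stub_hullVolume`, support S-a: slot-constant regime)

Record-only file (D-0012) of the abc-iut cell (WAVE-3 discharge seat abc-iut-c312-d1, gen 4); TAKES NO SIDE.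
Mochizuki, *Inter-universal Teichmüller theory IV* (RIMS ms Apr. 2020 = PRIMS **57** (2021)), Thm. 1.10 statement
p. 22 (`d*_mod := 2^12·3^3·5·d_mod`, `e*_mod := 2^12·3^3·5·e_mod ≤ d*_mod`), proof Step (iii) pp. 25–26 ((R1)–(R4),
`ι_{v_ℚ} := 1 if p_{v_ℚ} ≤ e*_mod·l`, `log(𝔰^ℚ)`, `log(𝔰^≤)`), Step (v) pp. 27–29 (`l*_mod := log(e*_mod·l)`),
Step (viii) p. 30 (`l*_mod·log(𝔰^≤) ≤ log(e*_mod·l)·Σ_{p ≤ e*_mod·l} 1`).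

Sequel to `LDHGenuineStepVSum.lean` (`hullEstimateOf_ofInput_explicit`: under SLOT-CONSTANCY of the canonical
`log(q_v)` over every support prime and the (R4)-shape tameness input with threshold `N` and size `l*`,
`HullEstimateOf I δ_K(I)`). THIS FILE specialises `N := e*_mod·l`, `l* := l*_mod = log(e*_mod·l)` (print's values)
and puts the constant in the K-LEVEL CURRENCY (V) of the route's junction (abc-iut-S3's
`Cor22.display_of_squeeze_min`, hypothesis `hδ`; route owner's CONTRACT 2026-08-26T01:47Z):

  `HullEstimateOf I ((l+1)/4·{(1 + 4/l)·dK + (4/l)·sQ + (20/3)·log(2^12·3^3·5·e_mod·l)·sLe})`             (V)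

for ANY reals `dK ≥ Σ_{p∈T(I)} (Σ_{v|p} n_v·d(K_{v̲}))/[F_mod:ℚ]·log p` (`= log(𝔡^K)|_{T(I)} ≤ log(𝔡^K)` when
`K/F_mod` is Galois — abc-iut-S1's `sum_dite_localDegree_mul_differentOrd_le_ndeg`, [IUTchI] Rmk. 3.1.5),
`sQ ≥ Σ_{p∈T(I)} log p` (`= log(𝔰^ℚ)` over `T(I)`), `sLe ≥ #{p ∈ T(I) : p ≤ e*_mod·l}` (`= log(𝔰^≤)` over `T(I)`):
* `card_filter_le_primeCounting` — **`#{p ∈ T(I) : p ≤ N} ≤ π(N)`** (`T(I)` consists of primes): the field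
  `sLe_le` of abc-iut-S3's `ProofData` / `hsLele` of `display_of_squeeze_min` DISCHARGED for the genuine datum;
* `r4_of_ramificationBounds` — **print's "(R1)–(R3), and hence (R4)"** (p. 25–26) as pure arithmetic: `e ≤
  2^11·3^3·5·e_mod·l^4`, and `e ≤ 2^11·3^3·5·e_mod·l` unless `p = l`, imply `e > p − 2 ⟹ p ≤ e*_mod·l ∧ 3 + log e ≤
  4·log(e*_mod·l)`; `r4_mono` — the (R4)-shape input is monotone in `e_mod` (so `e_mod ≤ d_mod` may be substituted,
  as [IUTchIV] Cor. 2.2 (ii) p. 46 l. 1 does); `r4_of_iotaForm` — from the `ι`-form "`3 + log e ≤ 4·ι_p·l*_mod`"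
  (`LDHGenuineStepV`'s `hR4` with `Dl.iota := ι_p`; abc-iut-S1's `PlaceSection.R4_localFieldFamily` for the genuine
  tower `F_mod ⊆ F ⊆ K`);
* `hullEstimateOf_ofInput_stepV` — (V) from slot-constancy + the (R4)-shape input at `e_mod`;
  `hullEstimateOf_ofInput_stepV_pi` — with `sLe := π(e*_mod·l)` and `sQ := Σ_{p∈T(I)} log p` substituted;
  `hullEstimateOf_ofInput_stepV_pi'` — the same with the prime as a free natural number `L = I.X.l` (the datum-level
  consumers' `l`, `ThetaVolumeDatumAt.l_eq`); the bookkeeping from (V) to the route's stub constant `B_III(P,l)`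
  (skeleton v1.2) is `Summits/ABC/ABC/Theorems/IUTThetaPilotThetaPartIIHullVolume.lean`;
  `hullEstimateOf_ofInput_stepV_of_iotaForm(_pi)` — the same with (R4) in the `ι`-form delivered by abc-iut-S1's
  `GenuineRamificationBounds(Datum)` and free `L`, `dK`, `sQ`, `sLe` (the hypotheses of abc-iut-S3's `Cor22.deltaK_le_BIII`);
  `hullEstimateOf_ofInput_stepV_of_ramificationBounds` — the same from the RAW ramification bounds (R1)–(R3) on the
  genuine completions `K_{v̲}` ([IUTchIV] Prop. 1.8 (v)(vii) + [IUTchI] Def. 3.1 (c) content, INPUT here);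
  `…_of_finrank_eq_one` — `d_mod = 1`: slot-constancy automatic.
What is NOT here (other seats, route owner's S-b): `dK ≤ log-diff + log-cond + log(2^11·3^3·5^2) + 2·log l` (Step
(ii)), `Σ_{p∈T(I)} log p ≤ 2·d_mod·(log-diff + log-cond) + log(2·3·5·l)` (Step (iii)), and the ramification bounds
themselves; the NON-slot-constant regime (plan/c312/STEPV-IND1-NOTE.md, VERDICT RISK 7) is untouched.
[cite: Mochizuki2012, IUTchIV Thm. 1.10 p. 22, proof Steps (iii), (v), (viii) p. 25–30] [claim: Mochizuki2012,
status: disputed] HONEST SCOPE: nothing asserts [IUTchIII] Cor. 3.12; (V) is the computable half only.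
-/

noncomputable section

namespace Summit.ABC.IUTFork

namespace DHData

open Finset Literature.IUT.LogVolume Literature.IUT.LogVolume.Thm110Local NumberField IsDedekindDomain

variable {F₀ : Type} [Field F₀] [NumberField F₀] {K : Type} [Field K] [NumberField K] [Algebra F₀ K]
variable (I : ThetaVolumeInput F₀ K)

/-! ## `log(𝔰^≤) ≤ π(e*_mod·l)` for the genuine datum -/

/-- **`#{p ∈ T(I) : p ≤ N} ≤ π(N)`**: the support primes are primes, so those `≤ N` lie in `primesLE N`
([IUTchIV] Step (viii) p. 30: "`log(𝔰^≤) ≤ Σ_{p ≤ e*_mod·l} 1` — where the sum ranges over the primes `p ≤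
e*_mod·l`"). [cite: Mochizuki2012, IUTchIV Thm. 1.10 proof Step (viii) p. 30] -/
theorem card_filter_le_primeCounting (N : ℕ) :
    (I.supportPrimes.filter (· ≤ N)).card ≤ Nat.primeCounting N := by
  rw [← Nat.primesLE_card_eq_primeCounting]
  refine Finset.card_le_card fun p hp => ?_
  rw [Finset.mem_filter] at hp
  exact Nat.mem_primesLE.mpr ⟨hp.2, I.prime_of_mem_supportPrimes hp.1⟩

/-- The same as a real inequality against any `sLe ≥ π(N)`. [cite: Mochizuki2012, IUTchIV Thm. 1.10 proof Step (viii) p. 30] -/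
theorem card_filter_le_of_primeCounting_le {N : ℕ} {sLe : ℝ} (h : (Nat.primeCounting N : ℝ) ≤ sLe) :
    ((I.supportPrimes.filter (· ≤ N)).card : ℝ) ≤ sLe :=
  le_trans (by exact_mod_cast card_filter_le_primeCounting I N) h

/-! ## (R1)–(R3) "and hence" (R4) ([IUTchIV] Step (iii) p. 25–26), pure arithmetic -/

omit [NumberField F₀] [NumberField K] in
/-- `3 < 37·log 2` (`log 2 > 0.693`). [folklore] -/
private theorem three_lt_37_log_two : (3 : ℝ) < 37 * Real.log 2 := by
  have h := Real.log_two_gt_d9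
  linarith

/-- **(R4) from the ramification bounds (R1)–(R3)** ([IUTchIV] Thm. 1.10 proof Step (iii), p. 25–26: "(R1) `log(e_v) ≤
log(2^11·3^3·5·e_mod·l^4)` if `v` divides `l`, (R2)/(R3) `log(e_v) ≤ log(2^11·3^3·5·e_mod·l)` [otherwise] … and hence
that (R4) if `e_v ≥ p_v − 1 > p_v − 2`, then `p_v ≤ 2^12·3^3·5·e_mod·l = e*_mod·l`, and `log(e_v) ≤ −3 +
4·log(e*_mod·l)`"): for a prime `p`, `e_mod ≥ 1`, `l ≥ 1` and a natural number `e` with `e ≤ 2^11·3^3·5·e_mod·l^4`, and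
`e ≤ 2^11·3^3·5·e_mod·l` unless `p = l`: if `e > p − 2` then `p ≤ e*_mod·l` and `3 + log e ≤ 4·log(e*_mod·l)`. Pure
arithmetic (`p ≤ e + 1`; `e³·2^11·3^3·5·e_mod·l^4 ≤ (2^12·3^3·5·e_mod·l)^4` as `e^3 ≤ 27 < 2^37`).
[cite: Mochizuki2012, IUTchIV Thm. 1.10 proof Step (iii) p. 25–26] -/
theorem r4_of_ramificationBounds {p e emod l : ℕ} (hp : p.Prime) (hemod : 1 ≤ emod) (hl : 1 ≤ l)
    (h1 : e ≤ 2 ^ 11 * 3 ^ 3 * 5 * emod * l ^ 4) (h2 : p ≠ l → e ≤ 2 ^ 11 * 3 ^ 3 * 5 * emod * l)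
    (he : p - 2 < e) :
    p ≤ 2 ^ 12 * 3 ^ 3 * 5 * emod * l ∧ 3 + Real.log e ≤ 4 * Real.log ((2 : ℝ) ^ 12 * 3 ^ 3 * 5 * emod * l) := by
  have hp2 := hp.two_le
  refine ⟨?_, ?_⟩
  · by_cases hpl : p = l
    · subst hpl
      have : 1 ≤ 2 ^ 12 * 3 ^ 3 * 5 * emod := Nat.one_le_iff_ne_zero.mpr (by positivity)
      calc p = 1 * p := (one_mul p).symm
        _ ≤ 2 ^ 12 * 3 ^ 3 * 5 * emod * p := Nat.mul_le_mul_right p this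
    · have h2' := h2 hpl
      have hpe : p ≤ e + 1 := by omega
      have hle : 2 ^ 11 * 3 ^ 3 * 5 * emod * l + 1 ≤ 2 ^ 12 * 3 ^ 3 * 5 * emod * l := by
        have : 1 ≤ emod * l := Nat.one_le_iff_ne_zero.mpr (by positivity)
        nlinarith
      omega
  · -- `3 + log e ≤ 4·log(e*·l)`: `e ≥ 1`, `log e ≤ log(2^11·3^3·5·e_mod·l^4)`, and `3 ≤ 37·log 2 ≤ log(2^37·…)`
    have he1 : 1 ≤ e := by omega
    have he1' : (1 : ℝ) ≤ e := by exact_mod_cast he1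
    have hemod' : (1 : ℝ) ≤ emod := by exact_mod_cast hemod
    have hl' : (1 : ℝ) ≤ l := by exact_mod_cast hl
    have hM : (e : ℝ) ≤ 2 ^ 11 * 3 ^ 3 * 5 * (emod : ℝ) * (l : ℝ) ^ 4 := by exact_mod_cast h1
    have hloge : Real.log e ≤ Real.log (2 ^ 11 * 3 ^ 3 * 5 * (emod : ℝ) * (l : ℝ) ^ 4) :=
      Real.log_le_log (by positivity) hM
    -- expand the logarithms of the products
    have hE : Real.log (2 ^ 11 * 3 ^ 3 * 5 * (emod : ℝ) * (l : ℝ) ^ 4) =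
        11 * Real.log 2 + 3 * Real.log 3 + Real.log 5 + Real.log emod + 4 * Real.log l := by
      rw [Real.log_mul (by positivity) (by positivity), Real.log_mul (by positivity) (by positivity),
        Real.log_mul (by positivity) (by positivity), Real.log_mul (by positivity) (by positivity),
        Real.log_pow, Real.log_pow, Real.log_pow]
      push_cast
      ring
    have hE' : Real.log ((2 : ℝ) ^ 12 * 3 ^ 3 * 5 * emod * l) =
        12 * Real.log 2 + 3 * Real.log 3 + Real.log 5 + Real.log emod + Real.log l := by
      rw [Real.log_mul (by positivity) (by positivity), Real.log_mul (by positivity) (by positivity),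
        Real.log_mul (by positivity) (by positivity), Real.log_mul (by positivity) (by positivity),
        Real.log_pow, Real.log_pow]
      push_cast
      ring
    have h3 : 0 ≤ Real.log 3 := Real.log_nonneg (by norm_num)
    have h5 : 0 ≤ Real.log 5 := Real.log_nonneg (by norm_num)
    have hem : 0 ≤ Real.log emod := Real.log_nonneg hemod'
    have h37 := three_lt_37_log_two
    rw [hE] at hloge
    rw [hE']
    linarith

/-- **The (R4)-shape input is monotone in `e_mod`**: if it holds at `e_mod` it holds at any `e_mod' ≥ e_mod` (so
"`e*_mod ≤ d*_mod`" may be substituted, [IUTchIV] Thm. 1.10 p. 22, Cor. 2.2 (ii) p. 46 l. 1).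
[cite: Mochizuki2012, IUTchIV Thm. 1.10 p. 22] -/
theorem r4_mono {p emod emod' l : ℕ} {x : ℝ} (h : emod ≤ emod') (hemod : 1 ≤ emod)
    (hR4 : p ≤ 2 ^ 12 * 3 ^ 3 * 5 * emod * l ∧ x ≤ 4 * Real.log ((2 : ℝ) ^ 12 * 3 ^ 3 * 5 * emod * l))
    (hl : 1 ≤ l) :
    p ≤ 2 ^ 12 * 3 ^ 3 * 5 * emod' * l ∧ x ≤ 4 * Real.log ((2 : ℝ) ^ 12 * 3 ^ 3 * 5 * emod' * l) := by
  refine ⟨hR4.1.trans (Nat.mul_le_mul_right l (Nat.mul_le_mul_left _ h)), hR4.2.trans ?_⟩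
  have hemod_r : (1 : ℝ) ≤ emod := by exact_mod_cast hemod
  have hl_r : (1 : ℝ) ≤ l := by exact_mod_cast hl
  have h' : (emod : ℝ) ≤ emod' := by exact_mod_cast h
  have hpos : (0 : ℝ) < (2 : ℝ) ^ 12 * 3 ^ 3 * 5 * emod * l := by positivity
  refine mul_le_mul_of_nonneg_left (Real.log_le_log hpos ?_) (by norm_num)
  have : (0 : ℝ) ≤ (2 : ℝ) ^ 12 * 3 ^ 3 * 5 * l := by positivity
  nlinarith

/-- **The (R4)-shape input from its `ι`-form** (the shape of abc-iut-c312-d1's `LDHGenuineStepV` hypothesis `hR4` with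
`Dl.iota := ι_p ∈ {0,1}`, `lmod := l*_mod`, and of abc-iut-S1's `PlaceSection.R4_localFieldFamily`: "`e > p − 2 ⟹ 3 + log e
≤ 4·ι_p·log(e*_mod·l)`", `ι_p := [p ≤ e*_mod·l]`): since `3 + log e > 0`, the `ι`-form forces `ι_p = 1`, i.e.
`p ≤ e*_mod·l`, and then `3 + log e ≤ 4·log(e*_mod·l)` — print's (R4), p. 26. [cite: Mochizuki2012, IUTchIV Thm. 1.10 proof Step (iii) p. 26] -/
theorem r4_of_iotaForm {p e emod l : ℕ}
    (h : p - 2 < e → 3 + Real.log e ≤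
      4 * (if p ≤ 2 ^ 12 * 3 ^ 3 * 5 * emod * l then (1 : ℝ) else 0) *
        Real.log (((2 ^ 12 * 3 ^ 3 * 5 * emod : ℕ) : ℝ) * l))
    (he : p - 2 < e) :
    p ≤ 2 ^ 12 * 3 ^ 3 * 5 * emod * l ∧ 3 + Real.log e ≤ 4 * Real.log ((2 : ℝ) ^ 12 * 3 ^ 3 * 5 * emod * l) := by
  have h' := h he
  have he1 : (1 : ℝ) ≤ e := by exact_mod_cast (show 1 ≤ e by omega)
  have hlog : 0 ≤ Real.log e := Real.log_nonneg he1
  have ecast : Real.log (((2 ^ 12 * 3 ^ 3 * 5 * emod : ℕ) : ℝ) * l) =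
      Real.log ((2 : ℝ) ^ 12 * 3 ^ 3 * 5 * emod * l) := by
    push_cast; ring_nf
  by_cases hp : p ≤ 2 ^ 12 * 3 ^ 3 * 5 * emod * l
  · rw [if_pos hp, mul_one, ecast] at h'
    exact ⟨hp, h'⟩
  · rw [if_neg hp, mul_zero, zero_mul] at h'
    exfalso
    linarith

/-! ## (V): the Step (v)–(viii) constant in the K-level currency `e*_mod·l`, `l*_mod` -/

/-- `l*_mod = log(e*_mod·l) ≥ 0`. [cite: Mochizuki2012, IUTchIV Thm. 1.10 proof Step (v) p. 28] -/
theorem lstarMod_nonneg {emod l : ℕ} (hemod : 1 ≤ emod) (hl : 1 ≤ l) :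
    0 ≤ Real.log ((2 : ℝ) ^ 12 * 3 ^ 3 * 5 * emod * l) := by
  have hemod_r : (1 : ℝ) ≤ emod := by exact_mod_cast hemod
  have hl_r : (1 : ℝ) ≤ l := by exact_mod_cast hl
  refine Real.log_nonneg ?_
  have : (1 : ℝ) ≤ (2 : ℝ) ^ 12 * 3 ^ 3 * 5 := by norm_num
  calc (1 : ℝ) = 1 * 1 * 1 := by ring
    _ ≤ (2 : ℝ) ^ 12 * 3 ^ 3 * 5 * emod * l := by gcongr

/-- **(V) — [IUTchIV] Thm. 1.10 Steps (v)–(viii) for the genuine datum in the K-level currency of the route's junction**,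
under SLOT-CONSTANCY of the canonical `log(q_v)` over every support prime and the (R4)-shape tameness input at `e_mod`
(p. 26/28: "`e_{v_i} > p_{v_ℚ} − 2` for some `i` ⟹ `p_{v_ℚ} ≤ e*_mod·l`, and `log(e_{v_i}) ≤ −3 + 4·log(e*_mod·l)`"):
`HullEstimateOf I ((l+1)/4·{(1 + 4/l)·dK + (4/l)·sQ + (20/3)·log(2^12·3^3·5·e_mod·l)·sLe})` for any `dK, sQ, sLe`
dominating the different sum `Σ_{p∈T(I)} (Σ_{v|p} n_v·d(K_{v̲}))/[F_mod:ℚ]·log p`, `Σ_{p∈T(I)} log p` and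
`#{p ∈ T(I) : p ≤ e*_mod·l}` — exactly hypothesis `hδ` of abc-iut-S3's `Cor22.display_of_squeeze_min`. From
`hullEstimateOf_ofInput_explicit` (`N := e*_mod·l`, `l* := l*_mod`) and monotonicity.
[cite: Mochizuki2012, IUTchIV Thm. 1.10 proof Steps (v)–(viii) p. 27–30] [claim: Mochizuki2012, status: disputed] -/
theorem hullEstimateOf_ofInput_stepV (emod : ℕ) (hemod : 1 ≤ emod) {dK sQ sLe : ℝ}
    (hdK : (∑ p ∈ I.supportPrimes, if hp : p.Prime then haveI : Fact p.Prime := ⟨hp⟩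
            (∑ v : placesOver F₀ p, (localDegree F₀ v.1 : ℝ) *
              differentOrd p ((I.σ.localFieldFamily p hp).k v)) / Module.finrank ℚ F₀ * Real.log p else 0) ≤ dK)
    (hsQ : ∑ p ∈ I.supportPrimes, Real.log p ≤ sQ)
    (hsLe : ((I.supportPrimes.filter (· ≤ 2 ^ 12 * 3 ^ 3 * 5 * emod * I.X.l)).card : ℝ) ≤ sLe)
    (hR4 : ∀ (p : ℕ) [hp : Fact p.Prime], p ∈ I.supportPrimes → ∀ v : placesOver F₀ p,
      p - 2 < absRamificationIdx p ((I.σ.localFieldFamily p hp.out).k v) →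
      p ≤ 2 ^ 12 * 3 ^ 3 * 5 * emod * I.X.l ∧
        3 + Real.log (absRamificationIdx p ((I.σ.localFieldFamily p hp.out).k v)) ≤
          4 * Real.log ((2 : ℝ) ^ 12 * 3 ^ 3 * 5 * emod * I.X.l))
    (hconst : ∀ p ∈ I.supportPrimes, ∀ v w : placesOver F₀ p,
      (ofInput I).logQloc p v = (ofInput I).logQloc p w) :
    I.HullEstimateOf
      (((I.X.l : ℝ) + 1) / 4 * ((1 + 4 / (I.X.l : ℝ)) * dK + 4 / (I.X.l : ℝ) * sQ
        + 20 / 3 * Real.log ((2 : ℝ) ^ 12 * 3 ^ 3 * 5 * emod * I.X.l) * sLe)) := by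
  have hl1 : 1 ≤ I.X.l := le_trans (by norm_num) I.X.five_le_l
  have hlmod := lstarMod_nonneg hemod hl1
  have h := hullEstimateOf_ofInput_explicit I (2 ^ 12 * 3 ^ 3 * 5 * emod * I.X.l) hlmod hR4 hconst
  refine hullEstimateOf_mono I h ?_
  have hl : (0 : ℝ) < I.X.l := by exact_mod_cast (lt_of_lt_of_le (by norm_num) hl1)
  have hc0 : (0 : ℝ) ≤ ((I.X.l : ℝ) + 1) / 4 := by positivity
  have hc1 : (0 : ℝ) ≤ 1 + 4 / (I.X.l : ℝ) := by positivity
  have hc2 : (0 : ℝ) ≤ 4 / (I.X.l : ℝ) := by positivity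
  have hc3 : (0 : ℝ) ≤ 20 / 3 * Real.log ((2 : ℝ) ^ 12 * 3 ^ 3 * 5 * emod * I.X.l) := by positivity
  refine mul_le_mul_of_nonneg_left ?_ hc0
  have e3 : 20 / 3 * Real.log ((2 : ℝ) ^ 12 * 3 ^ 3 * 5 * emod * I.X.l) *
      ((I.supportPrimes.filter (· ≤ 2 ^ 12 * 3 ^ 3 * 5 * emod * I.X.l)).card : ℝ) ≤
      20 / 3 * Real.log ((2 : ℝ) ^ 12 * 3 ^ 3 * 5 * emod * I.X.l) * sLe := mul_le_mul_of_nonneg_left hsLe hc3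
  have e1 := mul_le_mul_of_nonneg_left hdK hc1
  have e2 := mul_le_mul_of_nonneg_left hsQ hc2
  linarith

/-- **(V) with print's own values substituted**: `sQ := Σ_{p∈T(I)} log p` (`log(𝔰^ℚ)` over `T(I)`) and
`sLe := π(e*_mod·l)` (`log(𝔰^≤) ≤ Σ_{p ≤ e*_mod·l} 1`, Step (viii) p. 30 — `card_filter_le_primeCounting`), so that
abc-iut-S3's `hsLele` is `le_rfl`; `dK` any bound of the different sum.
[cite: Mochizuki2012, IUTchIV Thm. 1.10 proof Steps (v)–(viii) p. 27–30] [claim: Mochizuki2012, status: disputed] -/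
theorem hullEstimateOf_ofInput_stepV_pi (emod : ℕ) (hemod : 1 ≤ emod) {dK : ℝ}
    (hdK : (∑ p ∈ I.supportPrimes, if hp : p.Prime then haveI : Fact p.Prime := ⟨hp⟩
            (∑ v : placesOver F₀ p, (localDegree F₀ v.1 : ℝ) *
              differentOrd p ((I.σ.localFieldFamily p hp).k v)) / Module.finrank ℚ F₀ * Real.log p else 0) ≤ dK)
    (hR4 : ∀ (p : ℕ) [hp : Fact p.Prime], p ∈ I.supportPrimes → ∀ v : placesOver F₀ p,
      p - 2 < absRamificationIdx p ((I.σ.localFieldFamily p hp.out).k v) →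
      p ≤ 2 ^ 12 * 3 ^ 3 * 5 * emod * I.X.l ∧
        3 + Real.log (absRamificationIdx p ((I.σ.localFieldFamily p hp.out).k v)) ≤
          4 * Real.log ((2 : ℝ) ^ 12 * 3 ^ 3 * 5 * emod * I.X.l))
    (hconst : ∀ p ∈ I.supportPrimes, ∀ v w : placesOver F₀ p,
      (ofInput I).logQloc p v = (ofInput I).logQloc p w) :
    I.HullEstimateOf
      (((I.X.l : ℝ) + 1) / 4 * ((1 + 4 / (I.X.l : ℝ)) * dK + 4 / (I.X.l : ℝ) * (∑ p ∈ I.supportPrimes, Real.log p)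
        + 20 / 3 * Real.log ((2 : ℝ) ^ 12 * 3 ^ 3 * 5 * emod * I.X.l)
          * (Nat.primeCounting (2 ^ 12 * 3 ^ 3 * 5 * emod * I.X.l) : ℝ))) :=
  hullEstimateOf_ofInput_stepV I emod hemod hdK le_rfl
    (card_filter_le_of_primeCounting_le I le_rfl) hR4 hconst

/-- **(V) from the RAW ramification bounds (R1)–(R3) on the genuine completions** (`e(K_{v̲}) ≤ 2^11·3^3·5·e_mod·l^4`,
and `≤ 2^11·3^3·5·e_mod·l` over `p ≠ l`: [IUTchIV] Step (iii) p. 25, from Prop. 1.8 (v)(vii), (D0), [IUTchI] Def. 3.1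
(c) — INPUTS here), via `r4_of_ramificationBounds`, under slot-constancy.
[cite: Mochizuki2012, IUTchIV Thm. 1.10 proof Steps (iii), (v)–(viii) p. 25–30] [claim: Mochizuki2012, status: disputed] -/
theorem hullEstimateOf_ofInput_stepV_of_ramificationBounds (emod : ℕ) (hemod : 1 ≤ emod) {dK : ℝ}
    (hdK : (∑ p ∈ I.supportPrimes, if hp : p.Prime then haveI : Fact p.Prime := ⟨hp⟩
            (∑ v : placesOver F₀ p, (localDegree F₀ v.1 : ℝ) *
              differentOrd p ((I.σ.localFieldFamily p hp).k v)) / Module.finrank ℚ F₀ * Real.log p else 0) ≤ dK)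
    (hR1 : ∀ (p : ℕ) [hp : Fact p.Prime], p ∈ I.supportPrimes → ∀ v : placesOver F₀ p,
      absRamificationIdx p ((I.σ.localFieldFamily p hp.out).k v) ≤ 2 ^ 11 * 3 ^ 3 * 5 * emod * I.X.l ^ 4)
    (hR23 : ∀ (p : ℕ) [hp : Fact p.Prime], p ∈ I.supportPrimes → p ≠ I.X.l → ∀ v : placesOver F₀ p,
      absRamificationIdx p ((I.σ.localFieldFamily p hp.out).k v) ≤ 2 ^ 11 * 3 ^ 3 * 5 * emod * I.X.l)
    (hconst : ∀ p ∈ I.supportPrimes, ∀ v w : placesOver F₀ p,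
      (ofInput I).logQloc p v = (ofInput I).logQloc p w) :
    I.HullEstimateOf
      (((I.X.l : ℝ) + 1) / 4 * ((1 + 4 / (I.X.l : ℝ)) * dK + 4 / (I.X.l : ℝ) * (∑ p ∈ I.supportPrimes, Real.log p)
        + 20 / 3 * Real.log ((2 : ℝ) ^ 12 * 3 ^ 3 * 5 * emod * I.X.l)
          * (Nat.primeCounting (2 ^ 12 * 3 ^ 3 * 5 * emod * I.X.l) : ℝ))) := by
  have hl1 : 1 ≤ I.X.l := le_trans (by norm_num) I.X.five_le_l
  refine hullEstimateOf_ofInput_stepV_pi I emod hemod hdK (fun p hp hpT v hv => ?_) hconst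
  exact r4_of_ramificationBounds hp.out hemod hl1 (hR1 p hpT v) (fun hne => hR23 p hpT hne v) hv

/-- **(V) for `F_mod` of degree one** (e.g. `F_mod = ℚ`): slot-constancy is automatic
(`slotConstant_of_finrank_eq_one`), so (V) follows from the (R4)-shape input alone.
[cite: Mochizuki2012, IUTchIV Thm. 1.10 proof Steps (v)–(viii) p. 27–30] [claim: Mochizuki2012, status: disputed] -/
theorem hullEstimateOf_ofInput_stepV_pi_of_finrank_eq_one (hF : Module.finrank ℚ F₀ = 1) (emod : ℕ)
    (hemod : 1 ≤ emod) {dK : ℝ}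
    (hdK : (∑ p ∈ I.supportPrimes, if hp : p.Prime then haveI : Fact p.Prime := ⟨hp⟩
            (∑ v : placesOver F₀ p, (localDegree F₀ v.1 : ℝ) *
              differentOrd p ((I.σ.localFieldFamily p hp).k v)) / Module.finrank ℚ F₀ * Real.log p else 0) ≤ dK)
    (hR4 : ∀ (p : ℕ) [hp : Fact p.Prime], p ∈ I.supportPrimes → ∀ v : placesOver F₀ p,
      p - 2 < absRamificationIdx p ((I.σ.localFieldFamily p hp.out).k v) →
      p ≤ 2 ^ 12 * 3 ^ 3 * 5 * emod * I.X.l ∧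
        3 + Real.log (absRamificationIdx p ((I.σ.localFieldFamily p hp.out).k v)) ≤
          4 * Real.log ((2 : ℝ) ^ 12 * 3 ^ 3 * 5 * emod * I.X.l)) :
    I.HullEstimateOf
      (((I.X.l : ℝ) + 1) / 4 * ((1 + 4 / (I.X.l : ℝ)) * dK + 4 / (I.X.l : ℝ) * (∑ p ∈ I.supportPrimes, Real.log p)
        + 20 / 3 * Real.log ((2 : ℝ) ^ 12 * 3 ^ 3 * 5 * emod * I.X.l)
          * (Nat.primeCounting (2 ^ 12 * 3 ^ 3 * 5 * emod * I.X.l) : ℝ))) :=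
  hullEstimateOf_ofInput_stepV_pi I emod hemod hdK hR4 fun p hp v w => by
    haveI : Fact p.Prime := ⟨I.prime_of_mem_supportPrimes hp⟩
    exact slotConstant_of_finrank_eq_one hF _ v w


/-! ## In the currency of the route: `l` as a free natural number -/

/-- **(V) with the prime written as a free natural number `L = l`** (for the datum-level consumers, whose `l` is the
route's binder and whose input has `I.X.l = l` by `ThetaVolumeDatumAt.l_eq`): slot-constancy + the (R4)-shape input at
`e_mod` give `HullEstimateOf I ((L+1)/4·{(1 + 4/L)·dK + (4/L)·Σ_{p∈T(I)} log p + (20/3)·log(2^12·3^3·5·e_mod·L)·π(2^12·3^3·5·e_mod·L)})`.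
[cite: Mochizuki2012, IUTchIV Thm. 1.10 proof Steps (v)–(viii) p. 27–30] [claim: Mochizuki2012, status: disputed] -/
theorem hullEstimateOf_ofInput_stepV_pi' {L : ℕ} (hL : I.X.l = L) (emod : ℕ) (hemod : 1 ≤ emod) {dK : ℝ}
    (hdK : (∑ p ∈ I.supportPrimes, if hp : p.Prime then haveI : Fact p.Prime := ⟨hp⟩
            (∑ v : placesOver F₀ p, (localDegree F₀ v.1 : ℝ) *
              differentOrd p ((I.σ.localFieldFamily p hp).k v)) / Module.finrank ℚ F₀ * Real.log p else 0) ≤ dK)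
    (hR4 : ∀ (p : ℕ) [hp : Fact p.Prime], p ∈ I.supportPrimes → ∀ v : placesOver F₀ p,
      p - 2 < absRamificationIdx p ((I.σ.localFieldFamily p hp.out).k v) →
      p ≤ 2 ^ 12 * 3 ^ 3 * 5 * emod * L ∧
        3 + Real.log (absRamificationIdx p ((I.σ.localFieldFamily p hp.out).k v)) ≤
          4 * Real.log ((2 : ℝ) ^ 12 * 3 ^ 3 * 5 * emod * L))
    (hconst : ∀ p ∈ I.supportPrimes, ∀ v w : placesOver F₀ p,
      (ofInput I).logQloc p v = (ofInput I).logQloc p w) :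
    I.HullEstimateOf
      (((L : ℝ) + 1) / 4 * ((1 + 4 / (L : ℝ)) * dK + 4 / (L : ℝ) * (∑ p ∈ I.supportPrimes, Real.log p)
        + 20 / 3 * Real.log ((2 : ℝ) ^ 12 * 3 ^ 3 * 5 * emod * L)
          * (Nat.primeCounting (2 ^ 12 * 3 ^ 3 * 5 * emod * L) : ℝ))) := by
  subst hL
  exact hullEstimateOf_ofInput_stepV_pi I emod hemod hdK hR4 hconst


/-- **(V) with the (R4) input in its `ι`-form** — the exact output shape of abc-iut-S1's
`PlaceSection.R4_localFieldFamily` / `Cor22.R4_thetaVolumeInput` for the genuine tower ("`e > p − 2 ⟹ 3 + log e ≤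
4·ι_p·log(e*_mod·L)`", `ι_p := [p ≤ e*_mod·L]`), the prime as a free natural number `L = I.X.l`, and free
`dK, sQ, sLe` dominating the different sum, `Σ_{p∈T(I)} log p` and `#{p ∈ T(I) : p ≤ e*_mod·L}` — so that the S-b
holder's `Cor22.deltaK_le_BIII` (abc-iut-S3, `Theorem110TowerArith`) applies to the conclusion verbatim.
[cite: Mochizuki2012, IUTchIV Thm. 1.10 proof Steps (iii), (v)–(viii) p. 25–30] [claim: Mochizuki2012, status: disputed] -/
theorem hullEstimateOf_ofInput_stepV_of_iotaForm {L : ℕ} (hL : I.X.l = L) (emod : ℕ) (hemod : 1 ≤ emod)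
    {dK sQ sLe : ℝ}
    (hdK : (∑ p ∈ I.supportPrimes, if hp : p.Prime then haveI : Fact p.Prime := ⟨hp⟩
            (∑ v : placesOver F₀ p, (localDegree F₀ v.1 : ℝ) *
              differentOrd p ((I.σ.localFieldFamily p hp).k v)) / Module.finrank ℚ F₀ * Real.log p else 0) ≤ dK)
    (hsQ : ∑ p ∈ I.supportPrimes, Real.log p ≤ sQ)
    (hsLe : ((I.supportPrimes.filter (· ≤ 2 ^ 12 * 3 ^ 3 * 5 * emod * L)).card : ℝ) ≤ sLe)
    (hR4 : ∀ (p : ℕ) [hp : Fact p.Prime], p ∈ I.supportPrimes → ∀ v : placesOver F₀ p,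
      p - 2 < absRamificationIdx p ((I.σ.localFieldFamily p hp.out).k v) →
      3 + Real.log (absRamificationIdx p ((I.σ.localFieldFamily p hp.out).k v)) ≤
        4 * (if p ≤ 2 ^ 12 * 3 ^ 3 * 5 * emod * L then (1 : ℝ) else 0) *
          Real.log (((2 ^ 12 * 3 ^ 3 * 5 * emod : ℕ) : ℝ) * L))
    (hconst : ∀ p ∈ I.supportPrimes, ∀ v w : placesOver F₀ p,
      (ofInput I).logQloc p v = (ofInput I).logQloc p w) :
    I.HullEstimateOf
      (((L : ℝ) + 1) / 4 * ((1 + 4 / (L : ℝ)) * dK + 4 / (L : ℝ) * sQ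
        + 20 / 3 * Real.log ((2 : ℝ) ^ 12 * 3 ^ 3 * 5 * emod * L) * sLe)) := by
  subst hL
  exact hullEstimateOf_ofInput_stepV I emod hemod hdK hsQ hsLe
    (fun p hp hpT v hv => r4_of_iotaForm (hR4 p hpT v) hv) hconst

/-- **`sLe := π(e*_mod·l)` is admissible** in the previous theorem (`card_filter_le_primeCounting`), and then abc-iut-S3's
`hsLele : sLe ≤ π(2^12·3^3·5·e_mod·l)` is `le_rfl`. [cite: Mochizuki2012, IUTchIV Thm. 1.10 proof Step (viii) p. 30] -/
theorem hullEstimateOf_ofInput_stepV_of_iotaForm_pi {L : ℕ} (hL : I.X.l = L) (emod : ℕ) (hemod : 1 ≤ emod)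
    {dK sQ : ℝ}
    (hdK : (∑ p ∈ I.supportPrimes, if hp : p.Prime then haveI : Fact p.Prime := ⟨hp⟩
            (∑ v : placesOver F₀ p, (localDegree F₀ v.1 : ℝ) *
              differentOrd p ((I.σ.localFieldFamily p hp).k v)) / Module.finrank ℚ F₀ * Real.log p else 0) ≤ dK)
    (hsQ : ∑ p ∈ I.supportPrimes, Real.log p ≤ sQ)
    (hR4 : ∀ (p : ℕ) [hp : Fact p.Prime], p ∈ I.supportPrimes → ∀ v : placesOver F₀ p,
      p - 2 < absRamificationIdx p ((I.σ.localFieldFamily p hp.out).k v) →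
      3 + Real.log (absRamificationIdx p ((I.σ.localFieldFamily p hp.out).k v)) ≤
        4 * (if p ≤ 2 ^ 12 * 3 ^ 3 * 5 * emod * L then (1 : ℝ) else 0) *
          Real.log (((2 ^ 12 * 3 ^ 3 * 5 * emod : ℕ) : ℝ) * L))
    (hconst : ∀ p ∈ I.supportPrimes, ∀ v w : placesOver F₀ p,
      (ofInput I).logQloc p v = (ofInput I).logQloc p w) :
    I.HullEstimateOf
      (((L : ℝ) + 1) / 4 * ((1 + 4 / (L : ℝ)) * dK + 4 / (L : ℝ) * sQ
        + 20 / 3 * Real.log ((2 : ℝ) ^ 12 * 3 ^ 3 * 5 * emod * L)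
          * (Nat.primeCounting (2 ^ 12 * 3 ^ 3 * 5 * emod * L) : ℝ))) :=
  hullEstimateOf_ofInput_stepV_of_iotaForm I hL emod hemod hdK hsQ
    (card_filter_le_of_primeCounting_le I le_rfl) hR4 hconst

end DHData

end Summit.ABC.IUTFork

end
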